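import Literature.AlgebraicGeometry.Motives.AbelianVarietyTateModuleTraceDimensionFormula
import Literature.AlgebraicGeometry.Motives.AbelianVarietyInducedBrauerRelations
import HarnessLib

/-!
# Kani–Rosen dimension identities over an ARBITRARY field, from the `ℓ`-adic character
# `χ_ℓ(g) = Tr(ρ(g) | T_ℓ X)`: `Σ_i n_i dim B_{H_i} = 0` for every Brauer relation `Σ_i n_i H_i`,
# `dim B_{H₁} = dim B_{H₂}` for Gassmann triples, `w · dim B_G = Σ_i a_i dim B_{H_i}` for integral relations

For an abelian variety `X` over a field `K` with an action `ρ : G → End X` of a finite group, a subgroup `H ≤ G` with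
norm element `N_H = Σ_{h ∈ H} ρ(h)` and Kani–Rosen factor `B_H := Im N_H` ("the connected component of the `H`-fixed
points"), the tree proves the ISOGENIES of Kani–Rosen's Theorem 3 (`∏_i B_{H_i}^{a_i} ∼ ∏_j B_{H'_j}^{a'_j}` whenever
`Σ_i a_i (1_{H_i})^G = Σ_j a'_j (1_{H'_j})^G`; `Motives/AbelianVarietyBrauerRelationIsogenies`,
`Motives/AbelianVarietyArtinSolomonRelationIsogenies`) through the Hom-count criterion, hence over a PERFECT field
(Poincaré reducibility), and the DIMENSION identities `Σ_i a_i dim B_{H_i} = Σ_j a'_j dim B_{H'_j}`,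
`dim B_{H₁} = dim B_{H₂}` (Gassmann), `w · dim B_G = Σ_i a_i dim B_{H_i}` (integral relations, Artin, Solomon) only as
corollaries of those isogenies (`sum_mul_dim_eq_of_sum_smul_indClassFun_one_eq`, `dim_eq_of_gassmann`,
`mul_dim_eq_sum_of_intRelation`, `card_mul_dim_eq_sum_zpowers_of_artinRelation` — all `[PerfectField K]`).

This file removes the perfectness hypothesis from the DIMENSION statements.  The mechanism is the `ℓ`-adic
character of the action (Dokchitser–Green–Konstantinou–Morgan's additive functor lemma with `F = V_ℓ`, in the
lattice form of `Motives/AbelianVarietyTateModuleTraceDimensionFormula`): for a prime `ℓ` invertible in `K`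
(`ℓ ∈ {2, 3}` always works, `exists_prime_natCast_ne_zero`),

  `χ_ℓ(g) := Tr(T_ℓ ρ(g) | T_ℓ X) ∈ ℤ_ℓ`   is a CLASS FUNCTION on `G`                (`trace_tateModuleMap_asHom_conj`),
  `|H| · 2 dim B_H = Σ_{h ∈ H} χ_ℓ(h)`                                                  (the prequel, §3),

and Frobenius reciprocity in counting form (`card_smul_sum_subgroup_eq_sum_card_conj_smul`, valid for class functions
with values in any additive commutative monoid) turns the subgroup sum into a sum against the MARKS
`m_H(g) = |{x ∈ G : x⁻¹ g x ∈ H}| = |H| · (1_H)^G(g)`: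

  `|G| |H| · 2 dim B_H = Σ_{g ∈ G} m_H(g) χ_ℓ(g)`,  i.e.  `2 |G|² dim B_H = Σ_g |G| (1_H)^G(g) χ_ℓ(g)`
                                                                   (`card_mul_card_mul_two_mul_dim_image_eq_sum`),

so `dim B_H = ½ ⟨χ_ℓ, (1_H)^G⟩_G` depends on `H` only through its permutation character, LINEARLY: an identity of
permutation characters `Σ_i a_i (1_{H_i})^G = Σ_j a'_j (1_{H'_j})^G` (equivalently of marks,
`Σ_i a_i [G:H_i] m_{H_i} = Σ_j a'_j [G:H'_j] m_{H'_j}`) gives `Σ_i a_i dim B_{H_i} = Σ_j a'_j dim B_{H'_j}` over ANY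
field — "`Hom_G(Ind_H^G 1, V) ≃ V^H`, taking `V = H¹_ℓ(X)` […] `H¹_ℓ(X)^H ≃ H¹_ℓ(X/H)` […] by counting dimensions".
No isogeny, no Poincaré reducibility and no rationality of `χ_ℓ` is used (only the displayed subgroup sums are
natural numbers).

## Main statements (sorry-free; theorems only, no new definitions)

* §1 `tateModuleMap_asHom_map_mul`, `tateModuleMap_asHom_map_one`, **`trace_tateModuleMap_asHom_conj`** (`χ_ℓ` is a class
  function), `trace_tateModuleMap_asHom_inv_mul_mul`.
* §2 **`card_mul_card_mul_two_mul_dim_image_eq_sum`** (`|G| |H| 2 dim B_H = Σ_g m_H(g) χ_ℓ(g)`),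
  `card_sq_mul_two_mul_dim_image_eq_sum` (`|G|² 2 dim B_H = Σ_g [G:H] m_H(g) χ_ℓ(g)`),
  `card_sq_mul_two_mul_sum_mul_dim_image_eq_sum` (families with integer weights).
* §3 (any field; INTEGER weights `c_i, c'_j ∈ ℤ` on both sides throughout)
  `sum_mul_index_mul_card_conj_mem_eq_of_sum_intCast_smul_indClassFun_one_eq` (permutation characters ⟹ marks, `ℤ`-weights),
  **`sum_mul_dim_image_eq_of_intMarks_eq`**, `sum_mul_dim_image_eq_of_marks_eq` (`ℕ`-weights),
  **`sum_mul_dim_image_eq_of_sum_intCast_smul_indClassFun_one_eq`** (KANI–ROSEN'S THEOREM 3 ON DIMENSIONS: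
  `Σ_i c_i (1_{H_i})^G = Σ_j c'_j (1_{H'_j})^G ⟹ Σ_i c_i dim B_{H_i} = Σ_j c'_j dim B_{H'_j}`),
  `sum_mul_dim_image_eq_zero_of_sum_intCast_smul_indClassFun_one_eq_zero` (`Σ_i n_i (1_{H_i})^G = 0 ⟹ Σ_i n_i dim B_{H_i} = 0`),
  **`dim_image_eq_of_card_conj_mem_eq`** (equal marks — i.e. Gassmann equivalent — `⟹ dim B_{H₁} = dim B_{H₂}`),
  **`dim_image_eq_of_indClassFun_one_eq`** (`(1_{H₁})^G = (1_{H₂})^G ⟹ dim B_{H₁} = dim B_{H₂}`, through the tree's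
  dictionary `indClassFun_one_eq_iff_gassmann` of `Motives/AbelianVarietyInducedBrauerRelations`).
* §4 (any field) integral relations `w · 1_G = Σ_i a_i (1_{H_i})^G`:
  **`mul_dim_image_eq_sum_of_smul_one_eq_sum_smul_indClassFun_one`** (`w dim B_G = Σ_i a_i dim B_{H_i}`), ARTIN
  `card_mul_dim_image_eq_sum_zpowers_of_card_smul_one_eq` / `exists_int_card_mul_dim_image_eq_sum_zpowers`
  (`|G| dim B_G = Σ_z b_z dim B_{⟨z⟩}`), SOLOMON `exists_finsupp_dim_image_eq_sum_quasiElementary`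
  (`dim B_G = Σ_H a_H dim B_H`, `H` quasi-elementary).

Scope (stated, not hidden).  Dimensions only: the isogenies themselves remain perfect-field statements of the
prequels (whose dimension corollaries `sum_mul_dim_eq_of_sum_smul_indClassFun_one_eq`, `dim_eq_of_gassmann`,
`mul_dim_eq_sum_of_intRelation` with `ℕ`-weights / the Gassmann class-count hypothesis / the marks hypothesis are
recovered from §3–§4 by `card_conj_mem_eq_of_gassmann` and `mul_card_eq_sum_mul_index_mul_card_conj_mem_of_smul_one_eq`);
`B_H = Im N_H` (no quotient curves); `χ_ℓ` lives in `ℤ_ℓ` for one auxiliary prime `ℓ` invertible in `K` chosen inside each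
proof — no integrality or `ℓ`-independence of `χ_ℓ(g)` is claimed or used.

## References

* [KaniRosen1989] E. Kani, M. Rosen, *Idempotent relations and factors of Jacobians*, Math. Ann. 284 (1989) 307–327,
  Thm. 3 (as restated in [DokchitserEtAl2022] Thm. 1.3).
* [DokchitserEtAl2022] V. Dokchitser, H. Green, A. Konstantinou, A. Morgan, *Parity of ranks of Jacobians of curves*,
  Proc. LMS (2025), arXiv:2211.06357: §1.3 Thm. 1.3; §3, additive functor lemma (`F(Jac_{X/H}) ↔ F(J_X)^H`, composites
  `|H|`, `F = V_ℓ`); proof of Thm. 8.4 ("`Hom_G(Ind_H^G ρ, V) ≃ Hom_H(ρ, V)` […] `V = H¹_ℓ(X)` […] counting dimensions").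
* [PrasadRajan2003] D. Prasad, C. S. Rajan, *On an Archimedean analogue of Tate's conjecture*, J. Number Theory 99
  (2003), Lemma 1, Cor. 1 (Sunada), Cor. 4 (arXiv math/0203295 pp. 2–3).
* [Perlis1977] R. Perlis, *On the equation `ζ_K(s) = ζ_{K'}(s)`*, J. Number Theory 9 (1977), Thm. 1.
* [GordonEtAl2018] C. Gordon, E. Makover, B. Mützel, D. Webb, arXiv:1804.00031, §1 ("almost conjugate" =
  "representation equivalent", "as already observed by Gassmann").
* [BartelDokchitser2015] A. Bartel, T. Dokchitser, *Brauer relations in finite groups*, JEMS 17 (2015), §1 (definition),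
  §2 (Artin's relation).
* [Isaacs1976] I. M. Isaacs, *Character Theory of Finite Groups* (1976), Lemma 5.14, Cor. 5.23, Thm. 8.10.
* [LangeRodriguez2022] H. Lange, R. E. Rodríguez, *Decomposition of Jacobians by Prym Varieties*, LNM 2310 (2022),
  Prop. 2.9.3 and proof (PDF p. 46: "comparing dimensions `2 n_i dim B_i = h_i rk W_i`").
* [Milne1986AbelianVarieties] J. S. Milne, *Abelian varieties*, in Cornell–Silverman (1986), §12 Prop. 12.9.
-/

noncomputable section

open CategoryTheory CategoryTheory.Limits
open Literature.RepresentationTheory.FiniteGroups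
open Literature.NumberTheory.DiophantineGeometry

universe u

namespace Literature.AlgebraicGeometry.Motives

namespace AbelianVariety

/-! ## §1 The `ℓ`-adic character `χ_ℓ(g) = Tr(ρ(g) | T_ℓ X)` is a class function -/

section Character

variable {K : Type u} [Field K] (ℓ : ℕ) [Fact ℓ.Prime] {X : AbelianVariety K} {G : Type} [Group G] (ρ : G →* End X)

/-- `T_ℓ ρ(ab) = T_ℓ ρ(a) ∘ T_ℓ ρ(b)`: `g ↦ T_ℓ ρ(g)` is a representation `G → GL(T_ℓ X)` (`T_ℓ` is a functor,
composition in `End X` is `(ρ a · ρ b) = ρ b ≫ ρ a`). [cite: MumfordAV1970, §19 Thm. 3 (p. 176)] -/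
theorem tateModuleMap_asHom_map_mul (a b : G) :
    tateModuleMap ℓ (End.asHom (ρ (a * b))) =
      tateModuleMap ℓ (End.asHom (ρ a)) * tateModuleMap ℓ (End.asHom (ρ b)) := by
  rw [map_mul, show End.asHom (ρ a * ρ b) = End.asHom (ρ b) ≫ End.asHom (ρ a) from rfl, tateModuleMap_comp]
  rfl

/-- `T_ℓ ρ(1) = 1`. [cite: MumfordAV1970, §19 Thm. 3 (p. 176)] -/
theorem tateModuleMap_asHom_map_one : tateModuleMap ℓ (End.asHom (ρ 1)) = 1 := by
  rw [map_one, show End.asHom (1 : End X) = 𝟙 X from rfl, tateModuleMap_id]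
  rfl

/-- **The `ℓ`-adic character is a class function**: `Tr(ρ(a g a⁻¹) | T_ℓ X) = Tr(ρ(g) | T_ℓ X)` (`Tr(AB) = Tr(BA)` on the
`ℤ_ℓ`-module `T_ℓ X`). [cite: DokchitserEtAl2022, §3 (additive functor lemma, `F = V_ℓ`)] [cite: Milne1986AbelianVarieties, §12 Prop. 12.9] -/
theorem trace_tateModuleMap_asHom_conj (a g : G) :
    LinearMap.trace ℤ_[ℓ] (X.tateModule ℓ) (tateModuleMap ℓ (End.asHom (ρ (a * g * a⁻¹)))) =
      LinearMap.trace ℤ_[ℓ] (X.tateModule ℓ) (tateModuleMap ℓ (End.asHom (ρ g))) := by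
  rw [tateModuleMap_asHom_map_mul, LinearMap.trace_mul_comm, ← tateModuleMap_asHom_map_mul,
    show a⁻¹ * (a * g) = g by group]

/-- The same in the form `Tr(ρ(a⁻¹ g a)) = Tr(ρ(g))`. [cite: DokchitserEtAl2022, §3 (additive functor lemma, `F = V_ℓ`)] -/
theorem trace_tateModuleMap_asHom_inv_mul_mul (a g : G) :
    LinearMap.trace ℤ_[ℓ] (X.tateModule ℓ) (tateModuleMap ℓ (End.asHom (ρ (a⁻¹ * g * a)))) =
      LinearMap.trace ℤ_[ℓ] (X.tateModule ℓ) (tateModuleMap ℓ (End.asHom (ρ g))) := by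
  have h := trace_tateModuleMap_asHom_conj ℓ ρ a⁻¹ g
  rwa [inv_inv] at h

/-! ## §2 `|G| |H| · 2 dim B_H = Σ_{g ∈ G} m_H(g) χ_ℓ(g)`: the dimension of `B_H` is `½ ⟨χ_ℓ, (1_H)^G⟩` -/

variable [Fintype G]

/-- **`|G| · |H| · 2 dim B_H = Σ_{g ∈ G} m_H(g) · Tr(ρ(g) | T_ℓ X)`** for `B_H = Im N_H`, `N_H = Σ_{h ∈ H} ρ(h)`, `ℓ`
invertible in `K`, with the marks `m_H(g) = |{x ∈ G : x⁻¹ g x ∈ H}| = |H| (1_H)^G(g)`: the prequel's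
`|H| · 2 dim B_H = Σ_{h ∈ H} χ_ℓ(h)` (`dim V_ℓ(X)^H = ⟨χ_ℓ|_H, 1_H⟩_H`) rewritten by Frobenius reciprocity
`⟨χ|_H, 1_H⟩_H = ⟨χ, (1_H)^G⟩_G` in counting form (`card_smul_sum_subgroup_eq_sum_card_conj_smul`, `χ_ℓ` being a class
function) — "`Hom_G(Ind_H^G 1, V) ≃ V^H` […] `V = H¹_ℓ(X)` […] `H¹_ℓ(X)^H ≃ H¹_ℓ(X/H)`".
[cite: DokchitserEtAl2022, §3 (additive functor lemma) and proof of Thm. 8.4] [cite: PrasadRajan2003, proof of Lemma 1]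
[cite: LangeRodriguez2022, Prop. 2.9.3 and proof (PDF p. 46)] -/
theorem card_mul_card_mul_two_mul_dim_image_eq_sum {H₀ : Subgroup G} [Fintype H₀] {N₀ : X ⟶ X}
    (hN₀ : End.of N₀ = ∑ h : H₀, ρ h) (hℓ : (ℓ : K) ≠ 0) :
    (Fintype.card G : ℤ_[ℓ]) * Fintype.card H₀ * 2 * (image N₀).dim =
      ∑ g, (Nat.card {x : G // x⁻¹ * g * x ∈ H₀} : ℤ_[ℓ]) *
        LinearMap.trace ℤ_[ℓ] (X.tateModule ℓ) (tateModuleMap ℓ (End.asHom (ρ g))) := by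
  have h := card_smul_sum_subgroup_eq_sum_card_conj_smul H₀
    (fun g ↦ LinearMap.trace ℤ_[ℓ] (X.tateModule ℓ) (tateModuleMap ℓ (End.asHom (ρ g))))
    (fun a g ↦ trace_tateModuleMap_asHom_conj ℓ ρ a g)
  simp only [nsmul_eq_mul] at h
  rw [← card_mul_two_mul_dim_image_norm_eq_sum_trace_tateModuleMap ℓ ρ hN₀ hℓ] at h
  push_cast at h
  rw [show (Fintype.card G : ℤ_[ℓ]) * Fintype.card H₀ * 2 * (image N₀).dim =
    Fintype.card G * (Fintype.card H₀ * (2 * (image N₀).dim)) by ring]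
  exact h

/-- **`|G|² · 2 dim B_H = Σ_{g ∈ G} [G:H] m_H(g) · χ_ℓ(g)`** (`[G:H] m_H(g) = |G| (1_H)^G(g)`): the form LINEAR in the
permutation character, `2 |G| dim B_H = Σ_g (1_H)^G(g) χ_ℓ(g) = |G| ⟨χ_ℓ, (1_H)^G⟩`.
[cite: DokchitserEtAl2022, §3 (additive functor lemma) and proof of Thm. 8.4] [cite: KaniRosen1989, Thm. 3] -/
theorem card_sq_mul_two_mul_dim_image_eq_sum {H₀ : Subgroup G} [Fintype H₀] {N₀ : X ⟶ X}
    (hN₀ : End.of N₀ = ∑ h : H₀, ρ h) (hℓ : (ℓ : K) ≠ 0) :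
    (Fintype.card G : ℤ_[ℓ]) * Fintype.card G * 2 * (image N₀).dim =
      ∑ g, ((H₀.index * Nat.card {x : G // x⁻¹ * g * x ∈ H₀} : ℕ) : ℤ_[ℓ]) *
        LinearMap.trace ℤ_[ℓ] (X.tateModule ℓ) (tateModuleMap ℓ (End.asHom (ρ g))) := by
  have hidx : H₀.index * Fintype.card H₀ = Fintype.card G := by
    rw [← Nat.card_eq_fintype_card, Subgroup.index_mul_card, Nat.card_eq_fintype_card]
  have hG : (Fintype.card G : ℤ_[ℓ]) = (H₀.index : ℤ_[ℓ]) * Fintype.card H₀ := by rw [← Nat.cast_mul, hidx]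
  calc (Fintype.card G : ℤ_[ℓ]) * Fintype.card G * 2 * (image N₀).dim
      = (H₀.index : ℤ_[ℓ]) * ((Fintype.card G : ℤ_[ℓ]) * Fintype.card H₀ * 2 * (image N₀).dim) := by
        rw [hG]; ring
    _ = (H₀.index : ℤ_[ℓ]) * ∑ g, (Nat.card {x : G // x⁻¹ * g * x ∈ H₀} : ℤ_[ℓ]) *
          LinearMap.trace ℤ_[ℓ] (X.tateModule ℓ) (tateModuleMap ℓ (End.asHom (ρ g))) := by
        rw [card_mul_card_mul_two_mul_dim_image_eq_sum ℓ ρ hN₀ hℓ]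
    _ = ∑ g, ((H₀.index * Nat.card {x : G // x⁻¹ * g * x ∈ H₀} : ℕ) : ℤ_[ℓ]) *
          LinearMap.trace ℤ_[ℓ] (X.tateModule ℓ) (tateModuleMap ℓ (End.asHom (ρ g))) := by
        rw [Finset.mul_sum]
        exact Finset.sum_congr rfl fun g _ ↦ by push_cast; ring

variable {ι : Type} [Fintype ι] (H : ι → Subgroup G) [∀ i, Fintype (H i)] {N : ι → (X ⟶ X)} (a : ι → ℤ)

/-- The family form with INTEGER weights: **`|G|² · 2 · Σ_i a_i dim B_{H_i} = Σ_g (Σ_i a_i [G:H_i] m_{H_i}(g)) χ_ℓ(g)`**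
— the dimension character evaluated on the virtual permutation character `Σ_i a_i (1_{H_i})^G` (`a_i ∈ ℤ`), through
its marks. [cite: KaniRosen1989, Thm. 3] [cite: DokchitserEtAl2022, §3 (additive functor lemma, `F = V_ℓ`)] -/
theorem card_sq_mul_two_mul_sum_mul_dim_image_eq_sum (hN : ∀ i, End.of (N i) = ∑ h : H i, ρ h)
    (hℓ : (ℓ : K) ≠ 0) :
    (Fintype.card G : ℤ_[ℓ]) * Fintype.card G * 2 * ((∑ i, a i * ((image (N i)).dim : ℤ) : ℤ) : ℤ_[ℓ]) =
      ∑ g, ((∑ i, a i * (((H i).index * Nat.card {x : G // x⁻¹ * g * x ∈ H i} : ℕ) : ℤ) : ℤ) : ℤ_[ℓ]) *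
        LinearMap.trace ℤ_[ℓ] (X.tateModule ℓ) (tateModuleMap ℓ (End.asHom (ρ g))) := by
  have key := fun i ↦ card_sq_mul_two_mul_dim_image_eq_sum ℓ ρ (hN i) hℓ
  calc (Fintype.card G : ℤ_[ℓ]) * Fintype.card G * 2 * ((∑ i, a i * ((image (N i)).dim : ℤ) : ℤ) : ℤ_[ℓ])
      = ∑ i, (a i : ℤ_[ℓ]) * ((Fintype.card G : ℤ_[ℓ]) * Fintype.card G * 2 * (image (N i)).dim) := by
        push_cast
        rw [Finset.mul_sum]
        exact Finset.sum_congr rfl fun i _ ↦ by ring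
    _ = ∑ i, (a i : ℤ_[ℓ]) * ∑ g, (((H i).index * Nat.card {x : G // x⁻¹ * g * x ∈ H i} : ℕ) : ℤ_[ℓ]) *
          LinearMap.trace ℤ_[ℓ] (X.tateModule ℓ) (tateModuleMap ℓ (End.asHom (ρ g))) :=
        Finset.sum_congr rfl fun i _ ↦ by rw [key i]
    _ = ∑ g, ∑ i, (a i : ℤ_[ℓ]) * ((((H i).index * Nat.card {x : G // x⁻¹ * g * x ∈ H i} : ℕ) : ℤ_[ℓ]) *
          LinearMap.trace ℤ_[ℓ] (X.tateModule ℓ) (tateModuleMap ℓ (End.asHom (ρ g)))) := by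
        simp_rw [Finset.mul_sum]
        exact Finset.sum_comm
    _ = ∑ g, ((∑ i, a i * (((H i).index * Nat.card {x : G // x⁻¹ * g * x ∈ H i} : ℕ) : ℤ) : ℤ) : ℤ_[ℓ]) *
          LinearMap.trace ℤ_[ℓ] (X.tateModule ℓ) (tateModuleMap ℓ (End.asHom (ρ g))) :=
        Finset.sum_congr rfl fun g _ ↦ by
          push_cast
          rw [Finset.sum_mul]
          exact Finset.sum_congr rfl fun i _ ↦ by ring

end Character

/-! ## §3 Kani–Rosen's Theorem 3 on dimensions and Gassmann triples, over an arbitrary field -/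

section Marks

variable {G : Type} [Group G] [Fintype G] {ι ι' : Type} [Fintype ι] [Fintype ι'] (H : ι → Subgroup G)
  (H' : ι' → Subgroup G) (c : ι → ℤ) (c' : ι' → ℤ)

/-- **A `ℤ`-linear identity of permutation characters is an identity of marks**: if
`Σ_i c_i (1_{H_i})^G = Σ_j c'_j (1_{H'_j})^G` with `c_i, c'_j ∈ ℤ`, then for every `g ∈ G`
**`Σ_i c_i [G:H_i] m_{H_i}(g) = Σ_j c'_j [G:H'_j] m_{H'_j}(g)`** in `ℤ` (`|G| (1_H)^G(g) = [G:H] m_H(g)`,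
`card_mul_indClassFun_one_apply`; the tree's `sum_mul_index_mul_card_conj_mem_eq_of_sum_smul_indClassFun_one_eq` is the
case of natural-number weights). [cite: BartelDokchitser2015, §1 (definition of a Brauer relation)] [cite: Isaacs1976, Lemma 5.14] -/
theorem sum_mul_index_mul_card_conj_mem_eq_of_sum_intCast_smul_indClassFun_one_eq
    (h : ∑ i, (c i : ℂ) • indClassFun (H i) (1 : H i → ℂ) = ∑ j, (c' j : ℂ) • indClassFun (H' j) (1 : H' j → ℂ))
    (g : G) :
    ∑ i, c i * (((H i).index * Nat.card {x : G // x⁻¹ * g * x ∈ H i} : ℕ) : ℤ) =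
      ∑ j, c' j * (((H' j).index * Nat.card {x : G // x⁻¹ * g * x ∈ H' j} : ℕ) : ℤ) := by
  have hg := congrArg (fun f : G → ℂ ↦ (Fintype.card G : ℂ) * f g) h
  simp only [Finset.sum_apply, Pi.smul_apply, smul_eq_mul, Finset.mul_sum] at hg
  have e : ∀ (S : Subgroup G) (w : ℤ), (Fintype.card G : ℂ) * ((w : ℂ) * indClassFun S (1 : S → ℂ) g) =
      ((w * ((S.index * Nat.card {x : G // x⁻¹ * g * x ∈ S} : ℕ) : ℤ) : ℤ) : ℂ) := fun S w ↦ by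
    rw [mul_left_comm, card_mul_indClassFun_one_apply]; push_cast; ring
  simp only [e, ← Int.cast_sum] at hg
  exact_mod_cast hg

end Marks

section AnyField

variable {K : Type u} [Field K] {X : AbelianVariety K} {G : Type} [Group G] [Fintype G] (ρ : G →* End X)
  {ι ι' : Type} [Fintype ι] [Fintype ι'] (H : ι → Subgroup G) (H' : ι' → Subgroup G)
  [∀ i, Fintype (H i)] [∀ j, Fintype (H' j)] {N : ι → (X ⟶ X)} {N' : ι' → (X ⟶ X)}

/-- **Dimensions from a `ℤ`-linear identity of marks, over ANY field**: if
`Σ_i c_i [G:H_i] m_{H_i}(g) = Σ_j c'_j [G:H'_j] m_{H'_j}(g)` for every `g ∈ G` (`c_i, c'_j ∈ ℤ`; i.e.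
`Σ_i c_i (1_{H_i})^G = Σ_j c'_j (1_{H'_j})^G` cleared of denominators), then for every abelian variety `X` over any field
`K` with a `G`-action, **`Σ_i c_i dim B_{H_i} = Σ_j c'_j dim B_{H'_j}`** in `ℤ` (`B_H = Im N_H`, `End.of N_H = Σ_{h ∈ H} ρ h`).
Proof: both sides times `2|G|²` equal `Σ_g (marks) χ_ℓ(g)` in `ℤ_ℓ` for a prime `ℓ` invertible in `K` (§2), and
`ℤ → ℤ_ℓ` is injective. [cite: KaniRosen1989, Thm. 3] [cite: DokchitserEtAl2022, §1.3 Thm. 1.3 and §3 (additive functor lemma, `F = V_ℓ`)] -/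
theorem sum_mul_dim_image_eq_of_intMarks_eq (c : ι → ℤ) (c' : ι' → ℤ)
    (hmarks : ∀ g : G, ∑ i, c i * (((H i).index * Nat.card {x : G // x⁻¹ * g * x ∈ H i} : ℕ) : ℤ) =
      ∑ j, c' j * (((H' j).index * Nat.card {x : G // x⁻¹ * g * x ∈ H' j} : ℕ) : ℤ))
    (hN : ∀ i, End.of (N i) = ∑ h : H i, ρ h) (hN' : ∀ j, End.of (N' j) = ∑ h : H' j, ρ h) :
    ∑ i, c i * ((image (N i)).dim : ℤ) = ∑ j, c' j * ((image (N' j)).dim : ℤ) := by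
  obtain ⟨ℓ, hℓp, hℓ⟩ := AbelianVariety.exists_prime_natCast_ne_zero K
  haveI : Fact ℓ.Prime := ⟨hℓp⟩
  have h₁ := card_sq_mul_two_mul_sum_mul_dim_image_eq_sum ℓ ρ H c hN hℓ
  have h₂ := card_sq_mul_two_mul_sum_mul_dim_image_eq_sum ℓ ρ H' c' hN' hℓ
  simp only [hmarks] at h₁
  rw [← h₂] at h₁
  have hG : (Fintype.card G : ℤ_[ℓ]) ≠ 0 := Nat.cast_ne_zero.2 Fintype.card_ne_zero
  have hc : (Fintype.card G : ℤ_[ℓ]) * Fintype.card G * 2 ≠ 0 := mul_ne_zero (mul_ne_zero hG hG) two_ne_zero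
  exact Int.cast_injective (mul_left_cancel₀ hc h₁)

/-- The natural-number form: an identity of marks `Σ_i a_i [G:H_i] m_{H_i} = Σ_j a'_j [G:H'_j] m_{H'_j}` (`a_i, a'_j ∈ ℕ`,
the output of the tree's `sum_mul_index_mul_card_conj_mem_eq_of_sum_smul_indClassFun_one_eq`) gives
**`Σ_i a_i dim B_{H_i} = Σ_j a'_j dim B_{H'_j}`** over ANY field. [cite: KaniRosen1989, Thm. 3] [cite: DokchitserEtAl2022, §1.3 Thm. 1.3] -/
theorem sum_mul_dim_image_eq_of_marks_eq (a : ι → ℕ) (a' : ι' → ℕ)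
    (hmarks : ∀ g : G, ∑ i, a i * ((H i).index * Nat.card {x : G // x⁻¹ * g * x ∈ H i}) =
      ∑ j, a' j * ((H' j).index * Nat.card {x : G // x⁻¹ * g * x ∈ H' j}))
    (hN : ∀ i, End.of (N i) = ∑ h : H i, ρ h) (hN' : ∀ j, End.of (N' j) = ∑ h : H' j, ρ h) :
    ∑ i, a i * (image (N i)).dim = ∑ j, a' j * (image (N' j)).dim := by
  have h := sum_mul_dim_image_eq_of_intMarks_eq ρ H H' (fun i ↦ (a i : ℤ)) (fun j ↦ (a' j : ℤ))
    (fun g ↦ by exact_mod_cast hmarks g) hN hN'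
  exact_mod_cast h

/-- **KANI–ROSEN'S THEOREM 3 ON DIMENSIONS, OVER AN ARBITRARY FIELD, `ℤ`-linear form**: if the permutation characters
satisfy `Σ_i c_i (1_{H_i})^G = Σ_j c'_j (1_{H'_j})^G` (`c_i, c'_j ∈ ℤ`; the virtual permutation representation
`Σ_i c_i ℚ[G/H_i] − Σ_j c'_j ℚ[G/H'_j]` is zero — a Brauer relation), then for every action of the finite group `G` on an
abelian variety `X` over ANY field `K`, **`Σ_i c_i dim B_{H_i} = Σ_j c'_j dim B_{H'_j}`** (for Jacobians the genus
identity of a Brauer relation).  The tree's `sum_mul_dim_eq_of_sum_smul_indClassFun_one_eq` is the case `c, c' ≥ 0` over a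
PERFECT field, as a corollary of the isogeny `∏_i B_{H_i}^{a_i} ∼ ∏_j B_{H'_j}^{a'_j}`; here no isogeny is needed.
[cite: KaniRosen1989, Thm. 3] [cite: DokchitserEtAl2022, §1.3 Thm. 1.3, §3 (additive functor lemma, `F = V_ℓ`) and proof of Thm. 8.4]
[cite: BartelDokchitser2015, §1 (definition of a Brauer relation)] -/
theorem sum_mul_dim_image_eq_of_sum_intCast_smul_indClassFun_one_eq (c : ι → ℤ) (c' : ι' → ℤ)
    (h : ∑ i, (c i : ℂ) • indClassFun (H i) (1 : H i → ℂ) = ∑ j, (c' j : ℂ) • indClassFun (H' j) (1 : H' j → ℂ))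
    (hN : ∀ i, End.of (N i) = ∑ h : H i, ρ h) (hN' : ∀ j, End.of (N' j) = ∑ h : H' j, ρ h) :
    ∑ i, c i * ((image (N i)).dim : ℤ) = ∑ j, c' j * ((image (N' j)).dim : ℤ) :=
  sum_mul_dim_image_eq_of_intMarks_eq ρ H H' c c'
    (sum_mul_index_mul_card_conj_mem_eq_of_sum_intCast_smul_indClassFun_one_eq H H' c c' h) hN hN'

omit [Fintype ι'] [∀ j, Fintype (H' j)] in
/-- **The signed one-sided form (Bartel–Dokchitser's definition of a Brauer relation), any field**: if
`Σ_i n_i (1_{H_i})^G = 0` with `n_i ∈ ℤ`, then **`Σ_i n_i dim B_{H_i} = 0`** for every `G`-action on an abelian variety over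
any field. [cite: BartelDokchitser2015, §1] [cite: KaniRosen1989, Thm. 3] [cite: DokchitserEtAl2022, §1.3 Thm. 1.3] -/
theorem sum_mul_dim_image_eq_zero_of_sum_intCast_smul_indClassFun_one_eq_zero (n : ι → ℤ)
    (h0 : ∑ i, (n i : ℂ) • indClassFun (H i) (1 : H i → ℂ) = 0) (hN : ∀ i, End.of (N i) = ∑ h : H i, ρ h) :
    ∑ i, n i * ((image (N i)).dim : ℤ) = 0 := by
  have h : ∑ i, (n i : ℂ) • indClassFun (H i) (1 : H i → ℂ) =
      ∑ i, ((0 : ℤ) : ℂ) • indClassFun (H i) (1 : H i → ℂ) := by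
    rw [h0]
    simp only [Int.cast_zero, zero_smul, Finset.sum_const_zero]
  have key := sum_mul_dim_image_eq_of_sum_intCast_smul_indClassFun_one_eq ρ H H n (fun _ ↦ 0) h hN hN
  simpa only [zero_mul, Finset.sum_const_zero] using key

variable (H₁ H₂ : Subgroup G) [Fintype H₁] [Fintype H₂] {N₁ N₂ : X ⟶ X}

omit [Fintype ι] [Fintype ι'] [∀ i, Fintype (H i)] [∀ j, Fintype (H' j)] in
/-- **Subgroups with the same marks (equivalently: Gassmann equivalent / almost conjugate, `card_conj_mem_eq_of_gassmann`,
`card_isConj_eq_of_card_conj_mem_eq`) give factors of the same dimension, over ANY field**: if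
`|{x : x⁻¹gx ∈ H₁}| = |{x : x⁻¹gx ∈ H₂}|` for every `g ∈ G`, then `dim B_{H₁} = dim B_{H₂}` for every `G`-action on an abelian
variety over any field (Prasad–Rajan: `Jac(X/H₁) ∼ Jac(X/H₂)`; the tree's `dim_eq_of_gassmann` is the perfect-field
corollary of `isIsogenous_of_gassmann`).  Proof: `|G| |H| 2 dim B_H = Σ_g m_H(g) χ_ℓ(g)` and `|H₁| = |H₂|`.
[cite: PrasadRajan2003, Cor. 4 and Lemma 1] [cite: GordonEtAl2018, §1 Thm. 1.6] [cite: DokchitserEtAl2022, §3 (additive functor lemma, `F = V_ℓ`)] -/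
theorem dim_image_eq_of_card_conj_mem_eq
    (hm : ∀ g : G, Nat.card {x : G // x⁻¹ * g * x ∈ H₁} = Nat.card {x : G // x⁻¹ * g * x ∈ H₂})
    (hN₁ : End.of N₁ = ∑ h : H₁, ρ h) (hN₂ : End.of N₂ = ∑ h : H₂, ρ h) : (image N₁).dim = (image N₂).dim := by
  obtain ⟨ℓ, hℓp, hℓ⟩ := AbelianVariety.exists_prime_natCast_ne_zero K
  haveI : Fact ℓ.Prime := ⟨hℓp⟩
  have h₁ := card_mul_card_mul_two_mul_dim_image_eq_sum ℓ ρ hN₁ hℓ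
  have h₂ := card_mul_card_mul_two_mul_dim_image_eq_sum ℓ ρ hN₂ hℓ
  simp only [hm] at h₁
  rw [← h₂, card_eq_of_gassmann H₁ H₂ (card_isConj_eq_of_card_conj_mem_eq H₁ H₂ hm)] at h₁
  have hc : (Fintype.card G : ℤ_[ℓ]) * Fintype.card H₂ * 2 ≠ 0 :=
    mul_ne_zero (mul_ne_zero (Nat.cast_ne_zero.2 Fintype.card_ne_zero) (Nat.cast_ne_zero.2 Fintype.card_ne_zero))
      two_ne_zero
  exact Nat.cast_injective (mul_left_cancel₀ hc h₁)

omit [Fintype ι] [Fintype ι'] [∀ i, Fintype (H i)] [∀ j, Fintype (H' j)] in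
/-- **Equal permutation characters `(1_{H₁})^G = (1_{H₂})^G` — equivalently (the tree's dictionary
`indClassFun_one_eq_iff_gassmann`) GASSMANN EQUIVALENT subgroups — give `dim B_{H₁} = dim B_{H₂}` over ANY field**
(for Jacobians `g(X/H₁) = g(X/H₂)`: Perlis' `ζ_{K^{H₁}} = ζ_{K^{H₂}}` / Sunada's construction on genera; the tree's
`dim_eq_of_gassmann` needs a perfect field). [cite: Perlis1977, Thm. 1] [cite: PrasadRajan2003, Cor. 4]
[cite: GordonEtAl2018, §1 Thm. 1.6] -/
theorem dim_image_eq_of_indClassFun_one_eq (h : indClassFun H₁ (1 : H₁ → ℂ) = indClassFun H₂ (1 : H₂ → ℂ))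
    (hN₁ : End.of N₁ = ∑ h : H₁, ρ h) (hN₂ : End.of N₂ = ∑ h : H₂, ρ h) : (image N₁).dim = (image N₂).dim :=
  dim_image_eq_of_card_conj_mem_eq ρ H₁ H₂
    (card_conj_mem_eq_of_gassmann H₁ H₂ ((indClassFun_one_eq_iff_gassmann H₁ H₂).1 h)) hN₁ hN₂

end AnyField

/-! ## §4 Integral relations `w · 1_G = Σ_i a_i (1_{H_i})^G` over an arbitrary field: `w dim B_G = Σ_i a_i dim B_{H_i}`;
Artin's and Solomon's relations -/

section IntegralRelation

variable {K : Type u} [Field K] {X : AbelianVariety K} {G : Type} [Group G] [Fintype G] (ρ : G →* End X)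
  {ι : Type} [Fintype ι] (H : ι → Subgroup G) [∀ i, Fintype (H i)] {NG : X ⟶ X} {N : ι → (X ⟶ X)} (w : ℕ) (a : ι → ℤ)

/-- **Dimensions of an integral relation of permutation characters, over ANY field**: if
`w · 1_G = Σ_i a_i (1_{H_i})^G` (`w ∈ ℕ`, `a_i ∈ ℤ`; the shape of Artin's relation, `w = |G|`, `H_i` cyclic, and of
Solomon's, `w = 1`, `H_i` quasi-elementary), then for every `G`-action on an abelian variety over any field
**`w · dim B_G = Σ_i a_i dim B_{H_i}`** (in `ℤ`; `B_G = Im N_G`, `B_{H_i} = Im N_{H_i}`) — the tree's perfect-field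
`mul_dim_eq_sum_of_intRelation` without the isogeny.  Proof: as marks `w|G| = Σ_i a_i [G:H_i] m_{H_i}(g)`
(`mul_card_eq_sum_mul_index_mul_card_conj_mem_of_smul_one_eq`); sum against `χ_ℓ(g)`: `Σ_g χ_ℓ(g) = |G| 2 dim B_G` and
`Σ_g [G:H_i] m_{H_i}(g) χ_ℓ(g) = |G|² 2 dim B_{H_i}` (§2).
[cite: KaniRosen1989, Thm. 3] [cite: Isaacs1976, Cor. 5.23 and Thm. 8.10] [cite: DokchitserEtAl2022, §3 (additive functor lemma, `F = V_ℓ`)] -/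
theorem mul_dim_image_eq_sum_of_smul_one_eq_sum_smul_indClassFun_one
    (h : (w : ℂ) • (1 : G → ℂ) = ∑ i, (a i : ℂ) • indClassFun (H i) (1 : H i → ℂ))
    (hNG : End.of NG = ∑ g, ρ g) (hN : ∀ i, End.of (N i) = ∑ h : H i, ρ h) :
    (w : ℤ) * (image NG).dim = ∑ i, a i * ((image (N i)).dim : ℤ) := by
  have ha := mul_card_eq_sum_mul_index_mul_card_conj_mem_of_smul_one_eq H w a h
  obtain ⟨ℓ, hℓp, hℓ⟩ := AbelianVariety.exists_prime_natCast_ne_zero K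
  haveI : Fact ℓ.Prime := ⟨hℓp⟩
  have hfam := card_sq_mul_two_mul_sum_mul_dim_image_eq_sum ℓ ρ H a hN hℓ
  have hG := card_mul_two_mul_dim_image_normG_eq_sum_trace_tateModuleMap ℓ ρ hNG hℓ
  -- the marks side is the constant `w|G|`
  simp only [← ha] at hfam
  rw [← Finset.mul_sum, ← hG] at hfam
  -- `hfam : |G|² 2 (Σ_i a_i dim B_{H_i}) = (w|G|) (|G| 2 dim B_G)` in `ℤ_ℓ`; cancel `2|G|²` and descend to `ℤ`
  have hc : (Fintype.card G : ℤ_[ℓ]) * Fintype.card G * 2 ≠ 0 :=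
    mul_ne_zero (mul_ne_zero (Nat.cast_ne_zero.2 Fintype.card_ne_zero) (Nat.cast_ne_zero.2 Fintype.card_ne_zero))
      two_ne_zero
  have h' : (Fintype.card G : ℤ_[ℓ]) * Fintype.card G * 2 * (((w : ℤ) * (image NG).dim : ℤ) : ℤ_[ℓ]) =
      (Fintype.card G : ℤ_[ℓ]) * Fintype.card G * 2 * ((∑ i, a i * ((image (N i)).dim : ℤ) : ℤ) : ℤ_[ℓ]) := by
    rw [hfam]
    push_cast
    ring
  exact Int.cast_injective (mul_left_cancel₀ hc h')

/-- **Kani–Rosen ⊗ ARTIN on dimensions, any field**: for integers `b_z` with `|G| · 1_G = Σ_z b_z (1_{⟨z⟩})^G`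
(Artin's induction theorem for the principal character, `exists_int_card_smul_one_eq_sum_smul_indClassFun_zpowers`) and
every `G`-action on an abelian variety over any field, **`|G| · dim B_G = Σ_{z ∈ G} b_z dim B_{⟨z⟩}`** — the
dimension of the `G`-invariant part is determined by those of the CYCLIC subgroups (for curves
`|G| g(X/G) = Σ_z b_z g(X/⟨z⟩)`; the tree's `card_mul_dim_eq_sum_zpowers_of_artinRelation` needs a perfect field).
[cite: KaniRosen1989, Thm. 3] [cite: Isaacs1976, Cor. 5.23] [cite: BartelDokchitser2015, §2 (Artin's relation)] -/
theorem card_mul_dim_image_eq_sum_zpowers_of_card_smul_one_eq {N : G → (X ⟶ X)} (b : G → ℤ)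
    (hb : (Fintype.card G : ℂ) • (1 : G → ℂ) =
      ∑ z : G, (b z : ℂ) • indClassFun (Subgroup.zpowers z) (1 : Subgroup.zpowers z → ℂ))
    (hNG : End.of NG = ∑ g, ρ g) (hN : ∀ z, End.of (N z) = ∑ h : Subgroup.zpowers z, ρ h) :
    (Fintype.card G : ℤ) * (image NG).dim = ∑ z, b z * ((image (N z)).dim : ℤ) :=
  mul_dim_image_eq_sum_of_smul_one_eq_sum_smul_indClassFun_one ρ (fun z ↦ Subgroup.zpowers z) (Fintype.card G) b
    hb hNG hN

/-- The existential packaging, any field: **there are integers `b_z` depending only on `G` with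
`|G| · dim B_G = Σ_z b_z dim B_{⟨z⟩}` for EVERY `G`-action on an abelian variety over any field** (the tree's
`exists_int_isIsogenous_artinRelation` gives the isogeny over perfect fields). [cite: KaniRosen1989, Thm. 3] [cite: Isaacs1976, Cor. 5.23] -/
theorem exists_int_card_mul_dim_image_eq_sum_zpowers :
    ∃ b : G → ℤ, ∀ ⦃K : Type u⦄ [Field K] ⦃X : AbelianVariety K⦄ (ρ : G →* End X) ⦃NG : X ⟶ X⦄
      ⦃N : G → (X ⟶ X)⦄, End.of NG = ∑ g, ρ g → (∀ z, End.of (N z) = ∑ h : Subgroup.zpowers z, ρ h) →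
      (Fintype.card G : ℤ) * (image NG).dim = ∑ z, b z * ((image (N z)).dim : ℤ) := by
  obtain ⟨b, hb⟩ := exists_int_card_smul_one_eq_sum_smul_indClassFun_zpowers (G := G)
  exact ⟨b, fun K _ X ρ NG N hNG hN ↦ card_mul_dim_image_eq_sum_zpowers_of_card_smul_one_eq ρ b hb hNG hN⟩

open scoped Classical in
/-- **Kani–Rosen ⊗ SOLOMON on dimensions, any field**: there is a finitely supported integer vector `a` on the
subgroups of `G`, supported on QUASI-ELEMENTARY subgroups, with `1_G = Σ_H a_H (1_H)^G` (Solomon, Isaacs Thm. 8.10;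
`exists_finsupp_one_eq_sum_smul_indClassFun_quasiElementary`) and hence **`dim B_G = Σ_{H ∈ supp a} a_H dim B_H`** for
EVERY `G`-action on an abelian variety over any field — the `G`-invariant dimension is an INTEGRAL combination of
quasi-elementary ones (for curves `g(X/G) = Σ_H a_H g(X/H)`). [cite: Isaacs1976, Thm. 8.10] [cite: KaniRosen1989, Thm. 3] -/
theorem exists_finsupp_dim_image_eq_sum_quasiElementary :
    ∃ a : Subgroup G →₀ ℤ, (∀ H ∈ a.support, ∃ p : ℕ, p.Prime ∧ IsQuasiElementary H p) ∧
      ∀ ⦃K : Type u⦄ [Field K] ⦃X : AbelianVariety K⦄ (ρ : G →* End X) ⦃NG : X ⟶ X⦄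
        ⦃N : Subgroup G → (X ⟶ X)⦄, End.of NG = ∑ g, ρ g →
        (∀ H ∈ a.support, End.of (N H) = ∑ h : H, ρ h) →
        ((image NG).dim : ℤ) = ∑ H ∈ a.support, a H * ((image (N H)).dim : ℤ) := by
  obtain ⟨a, ha, h1⟩ := exists_finsupp_one_eq_sum_smul_indClassFun_quasiElementary (G := G)
  refine ⟨a, ha, fun K _ X ρ NG N hNG hN ↦ ?_⟩
  have h1' : ((1 : ℕ) : ℂ) • (1 : G → ℂ) = ∑ H : a.support, (a H : ℂ) • indClassFun (H : Subgroup G) 1 := by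
    rw [Nat.cast_one, one_smul, h1, ← Finset.sum_coe_sort]
  have key := mul_dim_image_eq_sum_of_smul_one_eq_sum_smul_indClassFun_one ρ (fun H : a.support ↦ (H : Subgroup G))
    1 (fun H ↦ a H) h1' hNG (fun H ↦ hN H H.2)
  rw [Nat.cast_one, one_mul] at key
  rw [key, ← Finset.sum_coe_sort a.support]

end IntegralRelation

end AbelianVariety

end Literature.AlgebraicGeometry.Motives
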